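import Mathlib.Geometry.Manifold.Instances.Sphere
import Mathlib.Geometry.Manifold.Diffeomorph
import Mathlib.Analysis.Normed.Group.BallSphere
import Mathlib.LinearAlgebra.CrossProduct
import Mathlib.Topology.Algebra.Module.FiniteDimension
import Literature.Geometry.Riemannian.CurvatureDecomposition
import Literature.Topology.FourManifolds.OrientationSign
import Literature.Geometry.Kaehler.ManifoldFormsPullback
import HarnessLib

/-!
# The twistor space of an oriented Riemannian 4-manifold, as a hypothesis package
(topic `Geometry/Riemannian`)

Let `(M, o, g)` be an oriented Riemannian 4-manifold. Its **twistor space** is the unit sphere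
bundle `π : Z = S(Λ⁺M) → M` of the rank-3 bundle of self-dual 2-forms — a point of `Z` over `x`
is a `g`-orthogonal complex structure `j` on `T_xM` compatible with `o` — a smooth 6-manifold with
the fibrewise antipodal involution `τ(j) = -j` (Atiyah–Hitchin–Singer 1978, §4; Besse 1987,
13.44–13.45 and 13.63, who write `S(Λ⁻)` for the opposite orientation) and with the closed
**coupling 2-form** `ω` of Reznikov (1993) / Fine–Panov (2009, Prop. 2.1) /
Fine–Krasnov–Panov (2014, §4.1): the curvature form `(i/2π) F` of the vertical tangent bundle
`V = ker π_* ⊂ TZ`, a Hermitian line bundle whose connection is induced by the Levi-Civita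
connection `∇` of `Λ⁺`. In the splitting `TZ = V ⊕ H_∇` (Fine–Panov 2009, Prop. 2.1):
`ω|_V` is `(2π)⁻¹ ×` the area form of the round fibre, `V ⊥_ω H_∇`, and on horizontal lifts
`ω(h̃, k̃) = (2π)⁻¹ ⟨F_∇(h, k), ζ⟩` pairs the curvature of `Λ⁺` with the point `ζ ∈ S(Λ⁺_x)`;
`ω` is symplectic iff `∇` is a *definite* connection (FKP 2014, Lemma 12 and Thm. 20).

A body-carrying construction of `Z` (bundle-level `Λ⁺`, sphere bundles as manifolds, induced
connections) is not available in the tree (work item `defn-TwistorSpace`, blocked), so, following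
`CONVENTIONS.md` §9 ("prefer a hypothesis structure"), this file provides

* `TwistorPackage M` — the DATA `(Z, proj, tau, omega)`: a smooth 6-manifold `Z` (Hausdorff,
  second countable, modelled on `ℝ⁶`), `proj : Z → M`, `tau : Z → Z`,
  `omega : MForm (𝓡 6) Z ℝ 2`, together with the STRUCTURAL AXIOMS every metric twistor space
  satisfies: `proj` is a smooth surjective submersion with fibres homeomorphic to `S²`; `tau` is a
  smooth free involution over `M`; `omega` is smooth, closed, `tau`-anti-invariant
  (`tau^* omega = -omega`) and non-degenerate on the vertical spaces `ker d proj`.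
* `IsTwistorSpaceOf g o P` — the CHARACTERISATION pinning the package down as THE twistor space
  of `(M, o, g)`: there is a tautological map `J : Z → End(ℝ⁴)` (`J z` = the complex structure of
  `T_{proj z} M` that `z` stands for) such that around every point of `M` there are an open set
  `U`, a smooth `o`-positive `g`-orthonormal frame field `e` on `U` and a diffeomorphism
  `Ψ : proj⁻¹ U ≅ U × S²` over `U` with (i) `Ψ ∘ tau = (id × antipodal) ∘ Ψ`,
  (ii) `J z = Σᵢ ζᵢ Jᵢ(e)` where `ζ = (Ψ z).2 ∈ S² ⊂ ℝ³` and `J₁, J₂, J₃` is the quaternionic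
  triple of complex structures attached to the positive orthonormal frame `e` ("raising an index"
  on Hamilton's self-dual basis `φᵢ(e)` of `CurvatureDecomposition.lean`, FKP 2014 §2.2), and
  (iii) `omega = Ψ^* Ω_e` where `Ω_e = couplingForm g ∇ e` is the **minimal-coupling form** of
  the Levi-Civita connection of `Λ⁺` written in the trivialisation induced by `e`
  (Sternberg–Weinstein; Fine–Panov 2009, Prop. 2.1): at `(x, ζ) ∈ U × S²`, on tangent vectors
  `(u₁, w₁), (u₂, w₂) ∈ T_xM × T_ζS²`,

      Ω_e = (2π)⁻¹ · ( ⟨ζ, θ₁ × θ₂⟩ - ⟨ζ, Φ(u₁, u₂)⟩ ),   θₖ = dι(wₖ) + c(uₖ) × ζ,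

  where `ι : S² → ℝ³` is the inclusion, `c(u)ᵢ = Σ_{(a,b) ∈ φᵢ} g(∇_u e_a, e_b)` is the `so(3) ≅ ℝ³`
  connection form of `∇` on `Λ⁺` in the orthonormal frame `φᵢ(e)/√2` (`∇ζ = θ`, the covariant
  differential of the tautological section) and `Φ(u,v)ᵢ = Σ_{(a,b) ∈ φᵢ} Rm(u, v, e_a, e_b)` is
  its curvature (`F_∇(u,v) w = Φ(u,v) × w`); the first term is the area form of the fibre
  (outward normal `ζ`) on vertical vectors, the second is the horizontal part, `V ⊥ H_∇`.
  The tautological `J` makes all local identifications canonical, so `IsTwistorSpaceOf g o P`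
  determines `(Z, proj, tau, omega)` up to fibre-preserving `tau`-equivariant `omega`-preserving
  diffeomorphism for EVERY metric (a uniqueness statement is not vended as a named fact here).
* the NAMED FACT `exists_twistorSpace` — every oriented Riemannian 4-manifold has a twistor
  space in this sense [AtiyahHitchinSinger1978 §4; Besse1987 13.44–13.45, 13.63;
  FinePanov2009 Prop. 2.1; FineKrasnovPanov2014 §4.1; Reznikov1993].

## Conventions (fixed here; checked numerically in the work folder, see the work-item notes)

* `Rm(X,Y,Z,W) = g(R(X,Y)Z, W)`, `R(X,Y) = ∇_X∇_Y - ∇_Y∇_X - ∇_{[X,Y]}` (the tree's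
  `curvatureForm`); `φ₁ = e₀∧e₁ + e₂∧e₃`, `φ₂ = e₀∧e₂ + e₃∧e₁`, `φ₃ = e₀∧e₃ + e₁∧e₂`
  (`selfDualPairs`, indices from `0`; self-dual for the orientation of `e`); "raising an index"
  `a ∧ b ↦ g(a,·) b - g(b,·) a` (`bivectorEnd`), under which `J₁ J₂ = J₃` (quaternion relations:
  the frame `φᵢ/√2` of `Λ⁺` is positively oriented in the sense of FKP 2014, §2.2) and the induced
  derivation of `Λ⁺ ≅ ℝ³` by `A ∈ so(T_xM)` is `w ↦ Φ_A × w`, `(Φ_A)ᵢ = Σ_{(a,b)∈φᵢ} g(A e_a, e_b)`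
  — whence the formulas for `c` and `Φ` above, and the structure equation `Φ = dc + c × c`.
* In terms of Hamilton's blocks (`blockA = (R(φᵢ,φⱼ))`, `blockB = (R(φᵢ,ψⱼ))`,
  `R(X∧Y, Z∧W) = Rm(X,Y,W,Z)`): `Φᵢ(u,v) = -R(u∧v, φᵢ) = -½ Σⱼ (Aᵢⱼ φⱼ♭(u,v) + Bᵢⱼ ψⱼ♭(u,v))`
  for orthonormal `e`; so the horizontal part of `Ω_e` at `ζ` is `(4π)⁻¹ (Aζ · φ♭ + Bᵀζ · ψ♭)`,
  non-degenerate iff `|A ζ| ≠ |Bᵀ ζ|` (FKP 2014, Lemma 12 + Thm. 20: `ω` symplectic iff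
  `(s/12 + W⁺)² > Ric₀* Ric₀`). Round `S⁴`: `B = 0`, `A = 2·Id`, `Φ = -φ♭`,
  `Ω_e(h̃_u, h̃_v) = (2π)⁻¹ g(J_ζ u, v)` — Kähler and positive for the Atiyah–Hitchin–Singer
  structure `J₊` (`J₊|_V = ζ × ·`, `J₊|_H = J_ζ`): `(Z, ω) ≅ (ℂP³, c·ω_FS)`, the Fano sign of
  FKP 2014, Prop. 15.
* The relative sign of the two terms of `Ω_e` is forced by `dΩ_e = 0` (`d` of each term is the
  3-form `⟨Φ ∧ θ⟩`); the factor `(2π)⁻¹` and the outward orientation of the fibres make `omega`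
  literally the curvature form `(i/2π)F_{∇^V}` of FKP 2014, §4.1 (`[ω] = c₁(V)`), equivalently
  `ω = ω_{S²} ⊕ 0 ⊕ h(F)` of Fine–Panov 2009, Prop. 2.1 (who use the opposite sign convention for
  curvature). The antipodal map pulls `Ω_e` back to `-Ω_e`.

## What is deliberately NOT here

The almost complex structures `J±` on `Z`, Chern classes, `Λ⁺` as a bundle, integration along
fibres, the non-degeneracy criterion and the symplectic-Fano property of `omega` (cite facts over
`(P, IsTwistorSpaceOf g o P)` to be filed separately), and a named uniqueness fact.

## References

* M. F. Atiyah, N. J. Hitchin, I. M. Singer, *Self-duality in four-dimensional Riemannian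
  geometry*, Proc. R. Soc. A 362 (1978), §4. [AtiyahHitchinSinger1978]
* A. L. Besse, *Einstein Manifolds* (1987), 13.44–13.46, 13.63–13.64. [Besse1987]
* J. Fine, D. Panov, *Symplectic Calabi–Yau manifolds, minimal surfaces and the hyperbolic
  geometry of the conifold*, J. Differential Geom. 82 (2009), §2.1, Prop. 2.1, Lemma 2.2.
  [FinePanov2009]
* J. Fine, K. Krasnov, D. Panov, *A gauge theoretic approach to Einstein 4-manifolds*, New York
  J. Math. 20 (2014), §2.2, §4.1 (Lemma 12, Remark 13), Thm. 20. [FineKrasnovPanov2014]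
* A. G. Reznikov, *Symplectic twistor spaces*, Ann. Global Anal. Geom. 11 (1993). [Reznikov1993]
* R. S. Hamilton, *Four-manifolds with positive isotropic curvature* (1997), §1.2. [Hamilton1997]
-/

noncomputable section

open Bundle Set Function
open scoped Manifold ContDiff Topology BigOperators Matrix

namespace Literature.Geometry.Riemannian

open Literature.Geometry.Lorentzian (PseudoRiemannianMetric)
open Literature.Geometry.Lorentzian.PseudoRiemannianMetric
open Literature.Geometry.Kaehler (MForm IsSmoothForm IsClosedForm)
open Literature.Topology.FourManifolds (SmoothOrientation)

/-- Local notation: the unit 2-sphere in `ℝ³`, with its analytic manifold structure `𝓡 2`. -/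
local notation "𝕊²" => (Metric.sphere (0 : EuclideanSpace ℝ (Fin 3)) 1)

/-! ### Pointwise linear algebra attached to a 4-frame -/

section Pointwise

variable {E : Type*} [NormedAddCommGroup E] [NormedSpace ℝ E] {H : Type*} [TopologicalSpace H]
  {I : ModelWithCorners ℝ E H} {M : Type*} [TopologicalSpace M] [ChartedSpace H M]
  [IsManifold I ∞ M] {n : ℕ∞ω}

variable (g : PseudoRiemannianMetric I n E (TangentSpace I : M → Type _))

/-- **"Raising an index" on a decomposable bivector**: the `g`-skew endomorphism
`v ↦ g(a, v) b - g(b, v) a` of `T_xM` attached to `a ∧ b` (for `g`-orthonormal `a, b` it is the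
rotation generator `a ↦ b ↦ -a` of the plane `⟨a, b⟩`; its 2-form `g(J·, ·)` is `(a ∧ b)♭`).
[cite: FineKrasnovPanov2014, §2.2] -/
def bivectorEnd (x : M) (a b : TangentSpace I x) : TangentSpace I x →L[ℝ] TangentSpace I x :=
  (g.val x a).smulRight b - (g.val x b).smulRight a

/-- `bivectorEnd g x a b v = g(a,v) b - g(b,v) a`. [folklore] -/
@[simp] theorem bivectorEnd_apply (x : M) (a b v : TangentSpace I x) :
    bivectorEnd g x a b v = g.val x a v • b - g.val x b v • a := rfl

/-- **The complex structure `J_ζ = Σᵢ ζᵢ Jᵢ(e)` attached to a 4-frame `e` and `ζ ∈ ℝ³`**, where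
`Jᵢ(e)` is obtained by raising an index on Hamilton's self-dual bivector `φᵢ(e)`
(`selfDualPairs e i`, `CurvatureDecomposition.lean`): `J₁ : e₀ ↦ e₁, e₂ ↦ e₃`,
`J₂ : e₀ ↦ e₂, e₃ ↦ e₁`, `J₃ : e₀ ↦ e₃, e₁ ↦ e₂`. For a positive `g`-orthonormal frame these
satisfy the quaternion relations `J₁J₂ = J₃`, and `ζ ↦ J_ζ` is a bijection from the unit sphere
`S² ⊂ ℝ³` onto the `g`-orthogonal complex structures on `T_xM` compatible with the orientation
of `e` — the fibre of the twistor space (FKP 2014, §2.2; Besse 1987, 13.44).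
[cite: FineKrasnovPanov2014, §2.2] -/
def frameComplexStructure (x : M) (e : Fin 4 → TangentSpace I x) (ζ : Fin 3 → ℝ) :
    TangentSpace I x →L[ℝ] TangentSpace I x :=
  ∑ i, ζ i • ∑ k, bivectorEnd g x (selfDualPairs e i k).1 (selfDualPairs e i k).2

/-- `J_{-ζ} = -J_ζ`: the antipodal map of the fibre is `j ↦ -j` (Besse 1987, 13.63 (2)).
[cite: Besse1987, 13.63] -/
theorem frameComplexStructure_neg (x : M) (e : Fin 4 → TangentSpace I x) (ζ : Fin 3 → ℝ) :
    frameComplexStructure g x e (-ζ) = -frameComplexStructure g x e ζ := by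
  simp only [frameComplexStructure, Pi.neg_apply, neg_smul, Finset.sum_neg_distrib]

/-- Index form of Hamilton's self-dual basis: `φ₁ = (0,1)+(2,3)`, `φ₂ = (0,2)+(3,1)`,
`φ₃ = (0,3)+(1,2)` (`selfDualPairs e i k = (e (selfDualIdx i k).1, e (selfDualIdx i k).2)`,
`selfDualPairs_eq`); needed to differentiate the frame VECTOR FIELDS entering the connection
form. [cite: Hamilton1997, §1.2, p. 5] -/
def selfDualIdx : Fin 3 → Fin 2 → Fin 4 × Fin 4 :=
  ![![(0, 1), (2, 3)], ![(0, 2), (3, 1)], ![(0, 3), (1, 2)]]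

omit [IsManifold I ∞ M] in
/-- `selfDualPairs` is `selfDualIdx` read through the frame. [cite: Hamilton1997, §1.2, p. 5] -/
theorem selfDualPairs_eq {x : M} (e : Fin 4 → TangentSpace I x) (i : Fin 3) (k : Fin 2) :
    selfDualPairs e i k = (e (selfDualIdx i k).1, e (selfDualIdx i k).2) := by
  fin_cases i <;> fin_cases k <;> rfl

variable (cov : CovariantDerivative I E (TangentSpace I : M → Type _))

/-- **The curvature of `Λ⁺` as an `ℝ³`-valued 2-form** in the orthonormal frame `φᵢ(e)/√2`:
`Φ(u,v)ᵢ = Σ_{(a,b) ∈ φᵢ} Rm(u, v, e_a, e_b)`, so that `F_∇(u,v) w = Φ(u,v) × w` on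
`Λ⁺_x ≅ ℝ³` (module docstring, Conventions; `= -½ Σⱼ (Aᵢⱼ φⱼ♭ + Bᵢⱼ ψⱼ♭)(u,v)` in terms of
Hamilton's blocks). [cite: FineKrasnovPanov2014, §2.1–2.2] -/
def selfDualCurvatureVec (x : M) (e : Fin 4 → TangentSpace I x) (u v : TangentSpace I x) :
    Fin 3 → ℝ :=
  fun i ↦ ∑ k, g.curvatureForm cov x u v (selfDualPairs e i k).1 (selfDualPairs e i k).2

/-- **The connection form of `∇` on `Λ⁺` as an `ℝ³`-valued 1-form** in the orthonormal frame
`φᵢ(e)/√2` of a frame FIELD `e` (vector fields `e a`, read at `x`):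
`c(u)ᵢ = Σ_{(a,b) ∈ φᵢ} g(e_b, ∇_u e_a)` (`= Σ g(∇_u e_a, e_b)`), so that
`∇_u (Σⱼ ζⱼ φⱼ/√2) = Σᵢ (c(u) × ζ)ᵢ φᵢ/√2` for constant `ζ` (recall Mathlib's argument order
`cov Y x u = (∇_u Y)(x)`). [cite: FinePanov2009, §2.1] -/
def selfDualConnectionVec (e : Fin 4 → Π y : M, TangentSpace I y) (x : M) (u : TangentSpace I x) :
    Fin 3 → ℝ :=
  fun i ↦ ∑ k, g.val x (e (selfDualIdx i k).2 x) (cov (e (selfDualIdx i k).1) x u)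

/-! ### The minimal-coupling form of a frame field on `M × S²` -/

/-- The connection form `u ↦ c(u)` (`selfDualConnectionVec`) as a linear map `T_xM → ℝ³`.
[cite: FinePanov2009, §2.1] -/
def selfDualConnectionLin (e : Fin 4 → Π y : M, TangentSpace I y) (x : M) :
    TangentSpace I x →ₗ[ℝ] (Fin 3 → ℝ) :=
  LinearMap.pi fun i ↦ ∑ k,
    ((g.val x (e (selfDualIdx i k).2 x)).comp (cov (e (selfDualIdx i k).1) x)).toLinearMap

/-- `selfDualConnectionLin` is `selfDualConnectionVec`. [folklore] -/
@[simp] theorem selfDualConnectionLin_apply (e : Fin 4 → Π y : M, TangentSpace I y) (x : M)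
    (u : TangentSpace I x) :
    selfDualConnectionLin g cov e x u = selfDualConnectionVec g cov e x u := by
  ext i
  simp [selfDualConnectionLin, selfDualConnectionVec]

/-- The curvature pairing `(u, v) ↦ g(b, R(u,v) a)` (`= Rm(u, v, a, b) = g(R(u,v) a, b)` by the
symmetry of `g`) as a bilinear map. [folklore] -/
def curvatureFormBilin (x : M) (a b : TangentSpace I x) :
    TangentSpace I x →ₗ[ℝ] TangentSpace I x →ₗ[ℝ] ℝ :=
  (cov.curvature x).toLinearMap₁₂.compr₂
    ((g.val x b).toLinearMap ∘ₗ LinearMap.applyₗ a ∘ₗ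
      ContinuousLinearMap.coeLM (R := ℝ) (M := TangentSpace I x) (N₃ := TangentSpace I x) ℝ)

/-- `curvatureFormBilin g cov x a b u v = g(b, R(u,v) a)`. [folklore] -/
@[simp] theorem curvatureFormBilin_apply (x : M) (a b u v : TangentSpace I x) :
    curvatureFormBilin g cov x a b u v = g.val x b (cov.curvature x u v a) := rfl

/-- `curvatureFormBilin g cov x a b u v = Rm(u, v, a, b)`. [folklore] -/
theorem curvatureFormBilin_apply' (x : M) (a b u v : TangentSpace I x) :
    curvatureFormBilin g cov x a b u v = g.curvatureForm cov x u v a b := by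
  rw [curvatureFormBilin_apply, curvatureForm, g.symm]

/-- **The covariant differential `θ = ∇ζ` of the tautological section** at `(x, ζ) ∈ M × S²` in
the trivialisation of a frame field `e`: the linear map
`(u, w) ↦ dι_ζ(w) + c(u) × ζ ∈ ℝ³` on `T_xM × T_ζS²`, where `ι : S² → ℝ³` is the inclusion
(`dι_ζ = mfderiv` of `Subtype.val`, with image `ζ^⊥`) and `c` the connection form
(`selfDualConnectionVec`); `θ ⊥ ζ`, and `θ = 0` cuts out the `∇`-horizontal space.
[cite: FinePanov2009, §2.1, Prop. 2.1] -/
def couplingTheta (e : Fin 4 → Π y : M, TangentSpace I y) (x : M) (ζ : 𝕊²) :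
    (TangentSpace I x × EuclideanSpace ℝ (Fin 2)) →ₗ[ℝ] (Fin 3 → ℝ) :=
  (WithLp.linearEquiv 2 ℝ (Fin 3 → ℝ)).toLinearMap ∘ₗ
      (mfderiv (𝓡 2) 𝓘(ℝ, EuclideanSpace ℝ (Fin 3))
          (Subtype.val : 𝕊² → EuclideanSpace ℝ (Fin 3)) ζ :
        EuclideanSpace ℝ (Fin 2) →L[ℝ] EuclideanSpace ℝ (Fin 3)).toLinearMap ∘ₗ
      LinearMap.snd ℝ (TangentSpace I x) (EuclideanSpace ℝ (Fin 2)) +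
    (crossProduct (R := ℝ)).flip (WithLp.ofLp (ζ : EuclideanSpace ℝ (Fin 3))) ∘ₗ
      selfDualConnectionLin g cov e x ∘ₗ
        LinearMap.fst ℝ (TangentSpace I x) (EuclideanSpace ℝ (Fin 2))

/-- `θ(u, w) = dι_ζ(w) + c(u) × ζ`. [cite: FinePanov2009, §2.1, Prop. 2.1] -/
theorem couplingTheta_apply (e : Fin 4 → Π y : M, TangentSpace I y) (x : M) (ζ : 𝕊²)
    (ξ : TangentSpace I x × EuclideanSpace ℝ (Fin 2)) :
    couplingTheta g cov e x ζ ξ =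
      WithLp.ofLp ((mfderiv (𝓡 2) 𝓘(ℝ, EuclideanSpace ℝ (Fin 3))
          (Subtype.val : 𝕊² → EuclideanSpace ℝ (Fin 3)) ζ :
        EuclideanSpace ℝ (Fin 2) →L[ℝ] EuclideanSpace ℝ (Fin 3)) ξ.2) +
      crossProduct (selfDualConnectionVec g cov e x ξ.1)
        (WithLp.ofLp (ζ : EuclideanSpace ℝ (Fin 3))) := by
  simp only [couplingTheta, LinearMap.add_apply, LinearMap.coe_comp, Function.comp_apply,
    LinearMap.fst_apply, LinearMap.flip_apply, selfDualConnectionLin_apply, LinearEquiv.coe_coe,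
    WithLp.linearEquiv_apply]
  rfl

/-- **`θ ⊥ ζ`**: the covariant differential of the unit tautological section is tangent to the
fibre sphere (`dι_ζ` has image `ζ^⊥`, Mathlib's `range_mfderiv_coe_sphere`, and
`⟨ζ, c × ζ⟩ = 0`). [cite: FinePanov2009, §2.1] -/
theorem dotProduct_couplingTheta (e : Fin 4 → Π y : M, TangentSpace I y) (x : M) (ζ : 𝕊²)
    (ξ : TangentSpace I x × EuclideanSpace ℝ (Fin 2)) :
    WithLp.ofLp (ζ : EuclideanSpace ℝ (Fin 3)) ⬝ᵥ couplingTheta g cov e x ζ ξ = 0 := by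
  haveI : Fact (Module.finrank ℝ (EuclideanSpace ℝ (Fin 3)) = 2 + 1) :=
    ⟨finrank_euclideanSpace_fin⟩
  have hr := range_mfderiv_coe_sphere (n := 2) ζ
  have hmem : (mfderiv (𝓡 2) 𝓘(ℝ, EuclideanSpace ℝ (Fin 3))
      (Subtype.val : 𝕊² → EuclideanSpace ℝ (Fin 3)) ζ :
        EuclideanSpace ℝ (Fin 2) →L[ℝ] EuclideanSpace ℝ (Fin 3)) ξ.2 ∈
      (Submodule.span ℝ {(ζ : EuclideanSpace ℝ (Fin 3))})ᗮ := by
    rw [← hr]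
    exact LinearMap.mem_range_self _ _
  have key : ∀ v : EuclideanSpace ℝ (Fin 3),
      v ∈ (Submodule.span ℝ {(ζ : EuclideanSpace ℝ (Fin 3))})ᗮ →
        WithLp.ofLp (ζ : EuclideanSpace ℝ (Fin 3)) ⬝ᵥ WithLp.ofLp v = 0 := by
    intro v hv
    have h := (Submodule.mem_orthogonal_singleton_iff_inner_right (𝕜 := ℝ)).mp hv
    rwa [EuclideanSpace.inner_eq_star_dotProduct, star_trivial, dotProduct_comm] at h
  rw [couplingTheta_apply, dotProduct_add, dot_cross_self, add_zero]
  exact key _ hmem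

/-- **The minimal-coupling bilinear form** of the frame field `e` at `(x, ζ) ∈ M × S²`:
`B((u₁,w₁), (u₂,w₂)) = (2π)⁻¹ (⟨ζ, θ₁ × θ₂⟩ - ⟨ζ, Φ(u₁,u₂)⟩)` with `θₖ = θ(uₖ, wₖ)`
(`couplingTheta`) and `Φ` the curvature vector (`selfDualCurvatureVec`) of the frame `e(x)`;
antisymmetric. First term: area form of the fibre (outward normal) on vertical vectors; second
term: the horizontal part `-(2π)⁻¹⟨ζ, F_∇⟩`; `V ⊥ H_∇`. [cite: FinePanov2009, Prop. 2.1] -/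
def couplingBilin (e : Fin 4 → Π y : M, TangentSpace I y) (x : M) (ζ : 𝕊²) :
    (TangentSpace I x × EuclideanSpace ℝ (Fin 2)) →ₗ[ℝ]
      (TangentSpace I x × EuclideanSpace ℝ (Fin 2)) →ₗ[ℝ] ℝ :=
  (2 * Real.pi)⁻¹ •
    (((crossProduct (R := ℝ)).compr₂
          (dotProductBilin ℝ ℝ (WithLp.ofLp (ζ : EuclideanSpace ℝ (Fin 3))))).compl₁₂
        (couplingTheta g cov e x ζ) (couplingTheta g cov e x ζ) -
      (∑ i : Fin 3, (WithLp.ofLp (ζ : EuclideanSpace ℝ (Fin 3))) i •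
          ∑ k : Fin 2, curvatureFormBilin g cov x (e (selfDualIdx i k).1 x)
            (e (selfDualIdx i k).2 x)).compl₁₂
        (LinearMap.fst ℝ (TangentSpace I x) (EuclideanSpace ℝ (Fin 2)))
        (LinearMap.fst ℝ (TangentSpace I x) (EuclideanSpace ℝ (Fin 2))))

/-- Unfolding `couplingBilin`:
`B(ξ₁, ξ₂) = (2π)⁻¹ (ζ · (θ ξ₁ × θ ξ₂) - ζ · Φ(ξ₁.1, ξ₂.1))`, `Φ` computed in the frame `e(x)`.
[cite: FinePanov2009, Prop. 2.1] -/
theorem couplingBilin_apply (e : Fin 4 → Π y : M, TangentSpace I y) (x : M) (ζ : 𝕊²)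
    (ξ₁ ξ₂ : TangentSpace I x × EuclideanSpace ℝ (Fin 2)) :
    couplingBilin g cov e x ζ ξ₁ ξ₂ =
      (2 * Real.pi)⁻¹ *
        (WithLp.ofLp (ζ : EuclideanSpace ℝ (Fin 3)) ⬝ᵥ
            crossProduct (couplingTheta g cov e x ζ ξ₁) (couplingTheta g cov e x ζ ξ₂) -
          WithLp.ofLp (ζ : EuclideanSpace ℝ (Fin 3)) ⬝ᵥ
            selfDualCurvatureVec g cov x (fun a ↦ e a x) ξ₁.1 ξ₂.1) := by
  simp only [couplingBilin, LinearMap.smul_apply, LinearMap.sub_apply, LinearMap.compl₁₂_apply,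
    LinearMap.compr₂_apply, dotProductBilin, LinearMap.coe_mk, AddHom.coe_mk,
    LinearMap.coe_sum, Finset.sum_apply, curvatureFormBilin_apply', LinearMap.fst_apply,
    smul_eq_mul, selfDualCurvatureVec, dotProduct, selfDualPairs_eq, Finset.mul_sum]

/-- The curvature vector is antisymmetric: `Φ(v, u) = -Φ(u, v)`. [folklore] -/
theorem selfDualCurvatureVec_swap (x : M) (e : Fin 4 → TangentSpace I x) (u v : TangentSpace I x) :
    selfDualCurvatureVec g cov x e v u = -selfDualCurvatureVec g cov x e u v := by
  ext i
  simp only [selfDualCurvatureVec, Pi.neg_apply, ← Finset.sum_neg_distrib]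
  refine Finset.sum_congr rfl fun k _ ↦ ?_
  rw [curvatureForm_antisymm]

/-- **The minimal-coupling bilinear form is antisymmetric.** [cite: FinePanov2009, Prop. 2.1] -/
theorem couplingBilin_swap (e : Fin 4 → Π y : M, TangentSpace I y) (x : M) (ζ : 𝕊²)
    (ξ₁ ξ₂ : TangentSpace I x × EuclideanSpace ℝ (Fin 2)) :
    couplingBilin g cov e x ζ ξ₂ ξ₁ = -couplingBilin g cov e x ζ ξ₁ ξ₂ := by
  rw [couplingBilin_apply, couplingBilin_apply, selfDualCurvatureVec_swap, ← cross_anticomm,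
    dotProduct_neg, dotProduct_neg]
  ring

/-- **On vertical vectors the minimal-coupling form is `(2π)⁻¹ ×` the area form of the fibre**
(outward normal `ζ`): `B((0, w₁), (0, w₂)) = (2π)⁻¹ det(ζ, dι w₁, dι w₂)`.
[cite: FinePanov2009, Prop. 2.1] -/
theorem couplingBilin_vertical (e : Fin 4 → Π y : M, TangentSpace I y) (x : M) (ζ : 𝕊²)
    (w₁ w₂ : EuclideanSpace ℝ (Fin 2)) :
    couplingBilin g cov e x ζ ((0 : TangentSpace I x), w₁) ((0 : TangentSpace I x), w₂) =
      (2 * Real.pi)⁻¹ *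
        (WithLp.ofLp (ζ : EuclideanSpace ℝ (Fin 3)) ⬝ᵥ
          crossProduct
            (WithLp.ofLp ((mfderiv (𝓡 2) 𝓘(ℝ, EuclideanSpace ℝ (Fin 3))
                (Subtype.val : 𝕊² → EuclideanSpace ℝ (Fin 3)) ζ :
              EuclideanSpace ℝ (Fin 2) →L[ℝ] EuclideanSpace ℝ (Fin 3)) w₁))
            (WithLp.ofLp ((mfderiv (𝓡 2) 𝓘(ℝ, EuclideanSpace ℝ (Fin 3))
                (Subtype.val : 𝕊² → EuclideanSpace ℝ (Fin 3)) ζ :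
              EuclideanSpace ℝ (Fin 2) →L[ℝ] EuclideanSpace ℝ (Fin 3)) w₂))) := by
  have h0 : selfDualCurvatureVec g cov x (fun a ↦ e a x) 0 0 = 0 := by
    ext i; simp [selfDualCurvatureVec, curvatureForm]
  have hc : selfDualConnectionVec g cov e x 0 = 0 := by
    ext i; simp [selfDualConnectionVec]
  rw [couplingBilin_apply, h0, dotProduct_zero, sub_zero, couplingTheta_apply, couplingTheta_apply]
  simp [hc]

/-- **On `∇`-horizontal vectors (`θ = 0`) the minimal-coupling form is `-(2π)⁻¹ ⟨ζ, F_∇⟩`.**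
[cite: FinePanov2009, Prop. 2.1] -/
theorem couplingBilin_of_couplingTheta_eq_zero (e : Fin 4 → Π y : M, TangentSpace I y) (x : M)
    (ζ : 𝕊²) {ξ₁ ξ₂ : TangentSpace I x × EuclideanSpace ℝ (Fin 2)}
    (h₁ : couplingTheta g cov e x ζ ξ₁ = 0) :
    couplingBilin g cov e x ζ ξ₁ ξ₂ =
      -((2 * Real.pi)⁻¹ *
        (WithLp.ofLp (ζ : EuclideanSpace ℝ (Fin 3)) ⬝ᵥ
          selfDualCurvatureVec g cov x (fun a ↦ e a x) ξ₁.1 ξ₂.1)) := by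
  rw [couplingBilin_apply, h₁, map_zero, LinearMap.zero_apply, dotProduct_zero, zero_sub,
    mul_neg]

variable [FiniteDimensional ℝ E]

/-- The minimal-coupling bilinear form as a continuous bilinear map (finite dimension).
[cite: FinePanov2009, Prop. 2.1] -/
def couplingBilinCLM (e : Fin 4 → Π y : M, TangentSpace I y) (x : M) (ζ : 𝕊²) :
    (E × EuclideanSpace ℝ (Fin 2)) →L[ℝ] (E × EuclideanSpace ℝ (Fin 2)) →L[ℝ] ℝ :=
  LinearMap.toContinuousLinearMap
    ((LinearMap.toContinuousLinearMap :
        ((E × EuclideanSpace ℝ (Fin 2)) →ₗ[ℝ] ℝ) ≃ₗ[ℝ]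
          ((E × EuclideanSpace ℝ (Fin 2)) →L[ℝ] ℝ)).toLinearMap ∘ₗ
      (couplingBilin g cov e x ζ :
        (E × EuclideanSpace ℝ (Fin 2)) →ₗ[ℝ] (E × EuclideanSpace ℝ (Fin 2)) →ₗ[ℝ] ℝ))

/-- `couplingBilinCLM` is `couplingBilin`. [folklore] -/
@[simp] theorem couplingBilinCLM_apply (e : Fin 4 → Π y : M, TangentSpace I y) (x : M) (ζ : 𝕊²)
    (ξ₁ ξ₂ : E × EuclideanSpace ℝ (Fin 2)) :
    couplingBilinCLM g cov e x ζ ξ₁ ξ₂ = couplingBilin g cov e x ζ ξ₁ ξ₂ := rfl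

/-- **The minimal-coupling 2-form `Ω_e` at `(x, ζ)`** as a continuous alternating map: the
antisymmetrisation `½ (B(ξ₁,ξ₂) - B(ξ₂,ξ₁))` (`= B(ξ₁,ξ₂)`, `B` being antisymmetric) of
`couplingBilin`, built with Mathlib's `ContinuousMultilinearMap.alternatization` exactly as the
tree's `twoFormOf` / `presymplecticAltFive`. [cite: FinePanov2009, Prop. 2.1] -/
def couplingAlt (e : Fin 4 → Π y : M, TangentSpace I y) (x : M) (ζ : 𝕊²) :
    (E × EuclideanSpace ℝ (Fin 2)) [⋀^Fin 2]→L[ℝ] ℝ :=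
  (2⁻¹ : ℝ) • ContinuousMultilinearMap.alternatization
    (ContinuousLinearMap.uncurryLeft
      (((continuousMultilinearCurryFin1 ℝ (E × EuclideanSpace ℝ (Fin 2)) ℝ).symm :
          ((E × EuclideanSpace ℝ (Fin 2)) →L[ℝ] ℝ) →L[ℝ] _).comp
        (couplingBilinCLM g cov e x ζ)))

/-- `Ω_e(ξ₁, ξ₂) = ½ (B(ξ₁, ξ₂) - B(ξ₂, ξ₁))`. [cite: FinePanov2009, Prop. 2.1] -/
theorem couplingAlt_apply (e : Fin 4 → Π y : M, TangentSpace I y) (x : M) (ζ : 𝕊²)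
    (ξ₁ ξ₂ : E × EuclideanSpace ℝ (Fin 2)) :
    couplingAlt g cov e x ζ ![ξ₁, ξ₂] =
      2⁻¹ * (couplingBilin g cov e x ζ ξ₁ ξ₂ - couplingBilin g cov e x ζ ξ₂ ξ₁) := by
  change (((2⁻¹ : ℝ) • ContinuousMultilinearMap.alternatization _ :
      (E × EuclideanSpace ℝ (Fin 2)) [⋀^Fin 2]→L[ℝ] ℝ))
    (show Fin 2 → (E × EuclideanSpace ℝ (Fin 2)) from ![ξ₁, ξ₂]) = _
  rw [ContinuousAlternatingMap.smul_apply,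
    ContinuousMultilinearMap.alternatization_apply_apply]
  have huniv : (Finset.univ : Finset (Equiv.Perm (Fin 2))) = {1, Equiv.swap 0 1} := by decide
  rw [huniv, Finset.sum_pair (by decide)]
  simp [Equiv.Perm.sign_swap', Units.smul_def, sub_eq_add_neg]

/-- `Ω_e(ξ₁, ξ₂) = B(ξ₁, ξ₂)` (`B = couplingBilin` is antisymmetric). [cite: FinePanov2009, Prop. 2.1] -/
theorem couplingAlt_apply' (e : Fin 4 → Π y : M, TangentSpace I y) (x : M) (ζ : 𝕊²)
    (ξ₁ ξ₂ : E × EuclideanSpace ℝ (Fin 2)) :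
    couplingAlt g cov e x ζ ![ξ₁, ξ₂] = couplingBilin g cov e x ζ ξ₁ ξ₂ := by
  rw [couplingAlt_apply, couplingBilin_swap]
  ring

/-- **The minimal-coupling form `Ω_e` of a frame field `e` on `M × S²`**
(Sternberg–Weinstein coupling form of the Levi-Civita connection `cov` on `Λ⁺` in the
trivialisation `S(Λ⁺)|_U ≅ U × S²` induced by `e`; meaningful over the open set where `e` is a
smooth positive `g`-orthonormal frame): the 2-form `(x, ζ) ↦ couplingAlt g cov e x ζ` on the
product manifold (model `I.prod (𝓡 2)`, tangent space `T_xM × T_ζS²`). By Fine–Panov 2009,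
Prop. 2.1 / FKP 2014, §4.1 it is the local expression of the closed coupling 2-form
`ω = (i/2π) F_{∇^V}` of the twistor space. [cite: FinePanov2009, Prop. 2.1] -/
def couplingForm (e : Fin 4 → Π y : M, TangentSpace I y) : MForm (I.prod (𝓡 2)) (M × 𝕊²) ℝ 2 :=
  fun p ↦ couplingAlt g cov e p.1 p.2

/-- Unfolding `couplingForm` at a point. [folklore] -/
@[simp] theorem couplingForm_apply (e : Fin 4 → Π y : M, TangentSpace I y) (p : M × 𝕊²) :
    couplingForm g cov e p = couplingAlt g cov e p.1 p.2 := rfl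

end Pointwise

/-! ### The hypothesis package -/

universe u

/-- **The twistor space of a smooth 4-manifold as a hypothesis package** (`CONVENTIONS.md` §9):
the DATA of a smooth 6-manifold `Z` (Hausdorff, second countable, modelled on `ℝ⁶`), a projection
`proj : Z → M`, an involution `tau : Z → Z` and a 2-form `omega`, together with the STRUCTURAL
AXIOMS satisfied by the twistor space `S(Λ⁺M) → M` of every oriented Riemannian metric on `M`
with its antipodal map and its Reznikov / Fine–Panov coupling form (module docstring):
`proj` is a smooth surjective submersion whose fibres are 2-spheres (AHS 1978, §4; Besse 1987,
13.44), `tau` is a smooth fixed-point-free involution preserving the fibres (Besse 1987,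
13.63 (2)), `omega` is smooth and closed (a curvature form: FKP 2014, §4.1), `tau^* omega =
-omega` (the antipodal map reverses the fibre orientation and the tautological section), and
`omega` is non-degenerate on the vertical spaces `ker (d proj)` (its restriction to a fibre is
`(2π)⁻¹ ×` the area form: Fine–Panov 2009, Prop. 2.1). WHICH metric the package belongs to is
said by `IsTwistorSpaceOf`; a bare package is NOT pinned down (e.g. `omega + proj^* β` for a
closed 2-form `β` on `M` satisfies the same axioms). [cite: FineKrasnovPanov2014, §4.1] -/
structure TwistorPackage (M : Type u) [TopologicalSpace M]
    [ChartedSpace (EuclideanSpace ℝ (Fin 4)) M] where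
  /-- The total space: a smooth 6-manifold. -/
  Z : Type u
  /-- The topology of the total space. -/
  [topologicalSpace : TopologicalSpace Z]
  /-- The total space is Hausdorff. -/
  [t2Space : T2Space Z]
  /-- The total space is second countable. -/
  [secondCountableTopology : SecondCountableTopology Z]
  /-- The total space is charted on `ℝ⁶`. -/
  [chartedSpace : ChartedSpace (EuclideanSpace ℝ (Fin 6)) Z]
  /-- The total space is a `C^∞` manifold. -/
  [isManifold : IsManifold (𝓡 6) ∞ Z]
  /-- The bundle projection `π : Z → M`. -/
  proj : Z → M
  /-- The fibrewise antipodal involution `τ`. -/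
  tau : Z → Z
  /-- The coupling 2-form `ω` (Reznikov; Fine–Panov; FKP `ω_A = (i/2π) F_∇`). -/
  omega : MForm (𝓡 6) Z ℝ 2
  /-- `π` is smooth. -/
  contMDiff_proj : ContMDiff (𝓡 6) (𝓡 4) ∞ proj
  /-- `π` is onto. -/
  proj_surjective : Function.Surjective proj
  /-- `π` is a submersion. -/
  mfderiv_proj_surjective : ∀ z, Function.Surjective (mfderiv (𝓡 6) (𝓡 4) proj z)
  /-- The fibres of `π` are 2-spheres. -/
  nonempty_fiber_homeomorph : ∀ x : M, Nonempty (↥(proj ⁻¹' {x}) ≃ₜ 𝕊²)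
  /-- `τ` is smooth. -/
  contMDiff_tau : ContMDiff (𝓡 6) (𝓡 6) ∞ tau
  /-- `τ` is an involution. -/
  tau_tau : ∀ z, tau (tau z) = z
  /-- `τ` has no fixed point. -/
  tau_ne : ∀ z, tau z ≠ z
  /-- `τ` preserves the fibres. -/
  proj_tau : ∀ z, proj (tau z) = proj z
  /-- `ω` is a smooth 2-form. -/
  isSmoothForm_omega : IsSmoothForm omega
  /-- `ω` is closed. -/
  isClosedForm_omega : IsClosedForm omega
  /-- `τ^* ω = -ω`. -/
  pullback_tau_omega : omega.pullback (𝓡 6) tau = -omega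
  /-- `ω` is non-degenerate on the vertical space `ker dπ_z` at every point. -/
  omega_vertical_nondegenerate : ∀ (z : Z) (v : TangentSpace (𝓡 6) z),
    mfderiv (𝓡 6) (𝓡 4) proj z v = 0 → v ≠ 0 →
      ∃ w : TangentSpace (𝓡 6) z, mfderiv (𝓡 6) (𝓡 4) proj z w = 0 ∧ omega z ![v, w] ≠ 0

namespace TwistorPackage

variable {M : Type u} [TopologicalSpace M] [ChartedSpace (EuclideanSpace ℝ (Fin 4)) M]
  (P : TwistorPackage M)

/-- The topology of the total space of a twistor package (bundled field, registered as an
instance on the new type `P.Z`; it overrides nothing). [folklore] -/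
instance instTopologicalSpaceZ : TopologicalSpace P.Z := P.topologicalSpace

/-- The total space of a twistor package is Hausdorff (bundled field). [folklore] -/
instance instT2SpaceZ : T2Space P.Z := P.t2Space

/-- The total space of a twistor package is second countable (bundled field). [folklore] -/
instance instSecondCountableTopologyZ : SecondCountableTopology P.Z := P.secondCountableTopology

/-- The total space of a twistor package is charted on `ℝ⁶` (bundled field). [folklore] -/
instance instChartedSpaceZ : ChartedSpace (EuclideanSpace ℝ (Fin 6)) P.Z := P.chartedSpace

/-- The total space of a twistor package is a `C^∞` manifold (bundled field). [folklore] -/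
instance instIsManifoldZ : IsManifold (𝓡 6) ∞ P.Z := P.isManifold

/-- The projection of a twistor package is continuous. [folklore] -/
theorem continuous_proj : Continuous P.proj := P.contMDiff_proj.continuous

/-- `τ` is a bijection (an involution). [folklore] -/
theorem tau_involutive : Function.Involutive P.tau := P.tau_tau

/-- The part `π⁻¹(U)` of the total space over an open set `U ⊆ M`, an open submanifold of `Z`.
[folklore] -/
def preim (U : TopologicalSpace.Opens M) : TopologicalSpace.Opens P.Z :=
  ⟨P.proj ⁻¹' (U : Set M), U.isOpen.preimage P.continuous_proj⟩

/-- Membership in `π⁻¹(U)`. [folklore] -/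
@[simp] theorem mem_preim {U : TopologicalSpace.Opens M} {z : P.Z} :
    z ∈ P.preim U ↔ P.proj z ∈ U :=
  Iff.rfl

/-- `τ` restricted to `π⁻¹(U)` (it preserves fibres). [folklore] -/
def tauOn (U : TopologicalSpace.Opens M) (z : P.preim U) : P.preim U :=
  ⟨P.tau z, by rw [mem_preim, P.proj_tau]; exact z.2⟩

/-- `tauOn` is `tau` on the underlying points. [folklore] -/
@[simp] theorem coe_tauOn (U : TopologicalSpace.Opens M) (z : P.preim U) :
    (P.tauOn U z : P.Z) = P.tau z := rfl

end TwistorPackage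

/-! ### The characterisation: being THE twistor space of `(M, o, g)` -/

section Characterisation

variable {M : Type u} [TopologicalSpace M] [ChartedSpace (EuclideanSpace ℝ (Fin 4)) M]
  [IsManifold (𝓡 4) ∞ M]

/-- **`P` is the twistor space of the oriented Riemannian 4-manifold `(M, o, g)`** (with its
antipodal involution and its Reznikov / Fine–Panov coupling form; module docstring): there is a
tautological map `J` assigning to `z : Z` an endomorphism `J z` of `T_{proj z}M = ℝ⁴` — the
`g`-orthogonal `o`-compatible complex structure that the point `z ∈ S(Λ⁺_{proj z})` stands for —
such that every point of `M` has an open neighbourhood `U` carrying a smooth `g`-orthonormal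
`o`-positive frame field `e = (e₀, …, e₃)` and a diffeomorphism `Ψ : proj⁻¹(U) ≅ U × S²` OVER `U`
(`(Ψ z).1 = proj z`) — the trivialisation of `S(Λ⁺)|_U` by the orthonormal frame `φᵢ(e)/√2` —
with: (i) `Ψ ∘ tau = (id × antipodal) ∘ Ψ`; (ii) `J z = J_ζ(e) = Σᵢ ζᵢ Jᵢ(e(proj z))` for
`ζ = (Ψ z).2` (`frameComplexStructure`); (iii) on `proj⁻¹(U)`, `omega` is the pull-back by `Ψ` of
the minimal-coupling form `Ω_e = couplingForm g g.leviCivita e` of the Levi-Civita connection on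
`Λ⁺` (Fine–Panov 2009, Prop. 2.1: vertical part `(2π)⁻¹ ×` the area form of the fibre, `V ⊥ H_∇`,
horizontal part `-(2π)⁻¹⟨ζ, F_∇⟩`; FKP 2014, §4.1: `ω = (i/2π) F_{∇^V}`). Since the local
identifications are forced by `J`, this determines `(Z, proj, tau, omega)` up to
fibre-preserving `tau`-equivariant `omega`-preserving diffeomorphism.
[cite: FineKrasnovPanov2014, §4.1, Lemma 12 and Remark 13] -/
def IsTwistorSpaceOf
    (g : PseudoRiemannianMetric (𝓡 4) ∞ (EuclideanSpace ℝ (Fin 4)) (TangentSpace (𝓡 4) : M → Type _))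
    [g.HasLeviCivita] (o : SmoothOrientation (𝓡 4) M) (P : TwistorPackage M) : Prop :=
  ∃ J : P.Z → (EuclideanSpace ℝ (Fin 4) →L[ℝ] EuclideanSpace ℝ (Fin 4)),
    ∀ x₀ : M, ∃ U : TopologicalSpace.Opens M, x₀ ∈ U ∧
      ∃ e : Fin 4 → (x : M) → TangentSpace (𝓡 4) x,
        (∀ a, ContMDiffOn (𝓡 4) (𝓡 4).tangent ∞
          (fun x ↦ (TotalSpace.mk' (EuclideanSpace ℝ (Fin 4)) x (e a x) : TangentBundle (𝓡 4) M))
          (U : Set M)) ∧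
        (∀ x ∈ U, g.IsOrthonormalFrame x (fun a ↦ e a x)) ∧
        (∀ x ∈ U, o.IsPosFrame x (fun i ↦ e (Fin.cast finrank_euclideanSpace_fin i) x)) ∧
        ∃ Ψ : (P.preim U) ≃ₘ⟮𝓡 6, (𝓡 4).prod (𝓡 2)⟯ (↥U × 𝕊²),
          (∀ z, ((Ψ z).1 : M) = P.proj z) ∧
          (∀ z, Ψ (P.tauOn U z) = ((Ψ z).1, -(Ψ z).2)) ∧
          (∀ z : P.preim U, J z = frameComplexStructure g (P.proj z) (fun a ↦ e a (P.proj z))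
            (WithLp.ofLp ((Ψ z).2 : EuclideanSpace ℝ (Fin 3)))) ∧
          P.omega.pullback (𝓡 6) (Subtype.val : P.preim U → P.Z) =
            (couplingForm g g.leviCivita e).pullback (𝓡 6)
              (fun z ↦ ((((Ψ z).1 : U) : M), (Ψ z).2))

/-- **The antipodal map reverses the tautological complex structure**: if `P` is the twistor space
of `(M, o, g)` then there is a tautological `J` as in `IsTwistorSpaceOf` with `J (tau z) = -J z`
for all `z` (clauses (i) and (ii) combined: `Ψ (tau z) = (x, -ζ)` and `J_{-ζ} = -J_ζ`;
Besse 1987, 13.63 (2): `τ(j) = -j`). [cite: Besse1987, 13.63] -/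
theorem IsTwistorSpaceOf.exists_tautological_tau
    {g : PseudoRiemannianMetric (𝓡 4) ∞ (EuclideanSpace ℝ (Fin 4)) (TangentSpace (𝓡 4) : M → Type _)}
    [g.HasLeviCivita] {o : SmoothOrientation (𝓡 4) M} {P : TwistorPackage M}
    (h : IsTwistorSpaceOf g o P) :
    ∃ J : P.Z → (EuclideanSpace ℝ (Fin 4) →L[ℝ] EuclideanSpace ℝ (Fin 4)),
      ∀ z, J (P.tau z) = -J z := by
  obtain ⟨J, hJ⟩ := h
  refine ⟨J, fun z ↦ ?_⟩
  obtain ⟨U, hxU, e, -, -, -, Ψ, -, hΨtau, hΨJ, -⟩ := hJ (P.proj z)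
  have hz : z ∈ P.preim U := hxU
  have h1 := hΨJ ⟨z, hz⟩
  have h2 := hΨJ (P.tauOn U ⟨z, hz⟩)
  rw [hΨtau] at h2
  simp only [TwistorPackage.coe_tauOn, coe_neg_sphere, WithLp.ofLp_neg,
    frameComplexStructure_neg] at h2
  have key : P.proj (P.tau z) = P.proj z := P.proj_tau z
  rw [h2, h1, key]
  rfl

end Characterisation

/-! ### Named fact: existence of the twistor space -/

/-- NAMED FACT (**existence of the twistor space**; Atiyah–Hitchin–Singer 1978, §4; Besse 1987,
13.44–13.45 and 13.63; Fine–Panov 2009, §2.1, Prop. 2.1; Fine–Krasnov–Panov 2014, §4.1;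
Reznikov 1993). For every smooth 4-manifold `M` (Hausdorff, second countable, modelled on `ℝ⁴`),
every smooth orientation `o` and every smooth Riemannian metric `g` on `M` (with its Levi-Civita
connection), the unit sphere bundle `Z = S(Λ⁺M)` of the self-dual 2-forms — a smooth 6-manifold,
Hausdorff and second countable, locally `U × S²` through any positive orthonormal frame — with its
projection, its fibrewise antipodal map `τ` and the closed coupling 2-form
`ω = (i/2π) F_{∇^V}` of the Levi-Civita connection on `Λ⁺` (whose expression in the
trivialisation of a positive orthonormal frame `e` is the minimal-coupling form `couplingForm`,
Fine–Panov 2009, Prop. 2.1) is a `TwistorPackage M` satisfying `IsTwistorSpaceOf g o`. Users take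
`(h : exists_twistorSpace)`. [cite: FineKrasnovPanov2014, §4.1, Lemma 12 and Remark 13] -/
def exists_twistorSpace : Prop :=
  ∀ (M : Type u) [TopologicalSpace M] [T2Space M] [SecondCountableTopology M]
    [ChartedSpace (EuclideanSpace ℝ (Fin 4)) M] [IsManifold (𝓡 4) ∞ M]
    (o : SmoothOrientation (𝓡 4) M)
    (g : PseudoRiemannianMetric (𝓡 4) ∞ (EuclideanSpace ℝ (Fin 4)) (TangentSpace (𝓡 4) : M → Type _))
    [g.HasLeviCivita], g.IsRiemannian → ∃ P : TwistorPackage.{u} M, IsTwistorSpaceOf g o P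

end Literature.Geometry.Riemannian

end
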